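import Summits.AnomalousDissipation.AnomalousDissipation.Cruxes.SubBallisticLiouville.StrategistCensus
import Literature.Analysis.FluidPDE.SteadyNSLiouville
import Literature.Analysis.FluidPDE.ClassicalSuitable

/-!
# Crux `SubBallisticLiouville` — the QUIET | LOUD decomposition (strategist r1, attempt D-r1)

Companion to `STRATEGY-CENSUS-r1.md`, heading `## Decomposition`. The crux
`C = SubBallisticLiouville` (`∀ h < 1, ∀ M, InEternalClass v → Growth h M v → SliceConst v`, see
`Strategist.crux_iff`) splits along the space–time MEAN DISSIPATION RATE
`ε_R(v) := R⁻⁵ ∫∫_{Q_R} |∇v|²`, `Q_R = [-R², R²] × B_R` (`|Q_R| ~ R⁵`):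

* `Quiet v` : `ε_R(v) → 0` (no anomalous dissipation along the parabolic exhaustion);
* `NoLoudStates` : every sub-ballistic (`h < 1`) eternal energy-class solution is quiet — the
  "anti-Kolmogorov" half (a K41 state with mean dissipation `ε > 0` has `∫∫_{Q_R}|∇v|² ~ ε R⁵`);
* `QuietLiouville` : the crux restricted to quiet solutions.

Kernel-checked here:
* `crux_of_noLoud_quiet : NoLoudStates → QuietLiouville → C` (the seam; trivial) and
  `quietLiouville_of_crux : C → QuietLiouville` (the quiet half is implied by `C`);
* `steadyDSolutionLiouvilleProblem_of_quietLiouville : QuietLiouville →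
  Literature.Analysis.FluidPDE.SteadyDSolutionLiouvilleProblem` — **the quiet half STILL contains
  Galdi's open Liouville problem** (a D-solution has
  `∫∫_{Q_R}|∇u|² ≤ 2R² ∫_{ℝ³}|∇u|² = O(R²) = o(R⁵)`: D-solutions are quiet), so the split does not
  produce a piece short of the summit-strength core;
  it only isolates the turbulence-facing half `NoLoudStates`, for which the very-weak class has no
  local energy inequality (census F3) and which at `h ≥ 1/3` is the negation of the K41 picture the
  route is trying to exploit. Hence NOT filed as `route edit --split` (census D-r1: no leverage).
-/

noncomputable section

-- `Summit.<Summit>.<Problem>`: single-conjunct summit; duplicate namespace mandated (CONVENTIONS)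
set_option linter.dupNamespace false

open MeasureTheory TopologicalSpace Set Function Filter Topology Metric
open scoped Laplacian InnerProductSpace RealInnerProductSpace ENNReal NNReal ContDiff
open Literature.Analysis.FluidPDE

namespace Summit.AnomalousDissipation.AnomalousDissipation.Cruxes.SubBallisticLiouville.StrategistR1

open Summit.AnomalousDissipation.AnomalousDissipation.Theses.KolmogorovLiouville
  (SubBallisticLiouville)
open Summit.AnomalousDissipation.AnomalousDissipation.Cruxes.SubBallisticLiouville.Strategist
  (InEternalClass Growth SliceConst crux_iff)

/-- QUIET: the solution admits a weak spatial gradient `G` on `ℝ × ℝ³` whose space–time Dirichlet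
energy on the parabolic cylinders `Q_R = [-R²,R²] × B_R` is `o(R⁵)`, i.e. the mean dissipation rate
`R⁻⁵ ∫∫_{Q_R} |G|²` tends to `0`. [folklore] -/
def Quiet (v : ℝ → EuclideanSpace ℝ (Fin 3) → EuclideanSpace ℝ (Fin 3)) : Prop :=
  ∃ G : ℝ → EuclideanSpace ℝ (Fin 3) →
      EuclideanSpace ℝ (Fin 3) →L[ℝ] EuclideanSpace ℝ (Fin 3),
    HasWeakSpatialGradientOn (slab (EuclideanSpace ℝ (Fin 3)) univ isOpen_univ) v G ∧
    ∀ ε : ℝ, 0 < ε → ∃ R₀ : ℝ, 1 ≤ R₀ ∧ ∀ R : ℝ, R₀ ≤ R →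
      ∫⁻ z in Icc (-R ^ 2) (R ^ 2) ×ˢ ball (0 : EuclideanSpace ℝ (Fin 3)) R,
          ENNReal.ofReal (frobeniusNormSq (G z.1 z.2)) ≤ ENNReal.ofReal (ε * R ^ 5)

/-- Piece 1 (the quiet half of the crux): sub-ballistic eternal energy-class solutions with
vanishing mean dissipation rate have a.e.-constant slices. [folklore] -/
def QuietLiouville : Prop :=
  ∀ (h M : ℝ), h < 1 → ∀ v : ℝ → EuclideanSpace ℝ (Fin 3) → EuclideanSpace ℝ (Fin 3),
    InEternalClass v → Growth h M v → Quiet v → SliceConst v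

/-- Piece 2 (the loud half, "no anomalous dissipation below ballistic growth"): every sub-ballistic
eternal energy-class solution is quiet. [folklore] -/
def NoLoudStates : Prop :=
  ∀ (h M : ℝ), h < 1 → ∀ v : ℝ → EuclideanSpace ℝ (Fin 3) → EuclideanSpace ℝ (Fin 3),
    InEternalClass v → Growth h M v → Quiet v

/-- The seam of the QUIET | LOUD split (modus ponens). [folklore] -/
theorem crux_of_noLoud_quiet : NoLoudStates → QuietLiouville → SubBallisticLiouville := by
  intro hN hQ
  rw [crux_iff]
  exact fun h M hh v hv hg => hQ h M hh v hv hg (hN h M hh v hv hg)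

/-- The quiet half is a consequence of the crux (it only adds a hypothesis). [folklore] -/
theorem quietLiouville_of_crux : SubBallisticLiouville → QuietLiouville :=
  fun hC h M hh v hv hg _ => (crux_iff.1 hC) h M hh v hv hg

/-! ## Steady classical solutions sit in the crux's class -/

/-- A `C²/C¹` steady solution `(U, P)` of `−ΔU + (U·∇)U + ∇P = 0`, `div U = 0` on `ℝ³`, viewed as
the time-independent field `t ↦ U`, lies in the eternal pressure-free energy class of the crux.
[folklore] -/
theorem inEternalClass_of_isLerayProfile
    {U : EuclideanSpace ℝ (Fin 3) → EuclideanSpace ℝ (Fin 3)} {P : EuclideanSpace ℝ (Fin 3) → ℝ}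
    (hprof : IsLerayProfile 1 0 U P) : InEternalClass (fun _ : ℝ => U) := by
  have hU2 : ContDiff ℝ 2 U := hprof.contDiff_velocity
  have hU1 : ContDiff ℝ 1 U := hU2.of_le one_le_two
  have hP1 : ContDiff ℝ 1 P := hprof.contDiff_pressure
  have hUc : Continuous U := hU2.continuous
  have cU : Continuous fun z : ℝ × EuclideanSpace ℝ (Fin 3) => U z.2 := hUc.comp continuous_snd
  have hQ : ((slab (EuclideanSpace ℝ (Fin 3)) univ isOpen_univ :
      Opens (ℝ × EuclideanSpace ℝ (Fin 3))) : Set (ℝ × EuclideanSpace ℝ (Fin 3))) ⊆ univ ×ˢ univ :=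
    fun z _ => ⟨mem_univ _, mem_univ _⟩
  obtain ⟨K, hK⟩ :
      ∃ K : ℝ → ℝ, ∀ R x, x ∈ closedBall (0 : EuclideanSpace ℝ (Fin 3)) R → ‖U x‖ ≤ K R :=
    ⟨fun R => Classical.choose ((isCompact_closedBall (0 : EuclideanSpace ℝ (Fin 3)) R)
        |>.exists_bound_of_continuousOn hUc.continuousOn),
      fun R => Classical.choose_spec ((isCompact_closedBall (0 : EuclideanSpace ℝ (Fin 3)) R)
        |>.exists_bound_of_continuousOn hUc.continuousOn)⟩
  dsimp only [InEternalClass]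
  refine ⟨cU.aestronglyMeasurable, ?_, ?_, ?_, ?_⟩
  · -- (2) `L^∞_t L²_x` locally, from local boundedness of the continuous `U`
    intro R _
    have hfin : ENNReal.ofReal (K R) ^ 2 * volume (ball (0 : EuclideanSpace ℝ (Fin 3)) R) ≠ ⊤ :=
      ENNReal.mul_ne_top (ENNReal.pow_ne_top ENNReal.ofReal_ne_top) measure_ball_lt_top.ne
    refine ⟨(ENNReal.ofReal (K R) ^ 2 * volume (ball (0 : EuclideanSpace ℝ (Fin 3)) R)).toNNReal,
      Eventually.of_forall fun t _ => ?_⟩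
    rw [ENNReal.coe_toNNReal hfin]
    calc ∫⁻ x in ball (0 : EuclideanSpace ℝ (Fin 3)) R, ‖U x‖ₑ ^ 2
        ≤ ∫⁻ _ in ball (0 : EuclideanSpace ℝ (Fin 3)) R, ENNReal.ofReal (K R) ^ 2 :=
          setLIntegral_mono measurable_const fun x hx => by
            refine pow_le_pow_left' ?_ 2
            rw [← ofReal_norm]
            exact ENNReal.ofReal_le_ofReal (hK R x (ball_subset_closedBall hx))
      _ = ENNReal.ofReal (K R) ^ 2 * volume (ball (0 : EuclideanSpace ℝ (Fin 3)) R) :=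
          setLIntegral_const _ _
  · -- (3) weakly divergence free slices
    exact Eventually.of_forall fun _ =>
      VectorCalculus.IsDivFree.isWeaklyDivFree_holds hprof.divFree hU1
  · -- (4) the weak spatial gradient is the classical one, locally square integrable
    refine ⟨fun _ x => fderiv ℝ U x, ?_, ?_⟩
    · have hu1 : ContDiffOn ℝ 1 (uncurry fun _ : ℝ => U) (univ ×ˢ univ) :=
        (hU1.comp contDiff_snd).contDiffOn
      exact hasWeakSpatialGradientOn_of_contDiffOn isOpen_univ hQ hu1
    · intro R _
      have hc : Continuous fun x : EuclideanSpace ℝ (Fin 3) => frobeniusNormSq (fderiv ℝ U x) :=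
        LerayHopfProofs.continuous_frobeniusNormSq.comp (hU1.continuous_fderiv one_ne_zero)
      obtain ⟨Mf, hMf⟩ := (isCompact_closedBall (0 : EuclideanSpace ℝ (Fin 3)) R)
        |>.exists_bound_of_continuousOn hc.continuousOn
      have hle : ∀ z ∈ Icc (-R ^ 2) (R ^ 2) ×ˢ ball (0 : EuclideanSpace ℝ (Fin 3)) R,
          ENNReal.ofReal (frobeniusNormSq (fderiv ℝ U z.2)) ≤ ENNReal.ofReal Mf := by
        intro z hz
        refine ENNReal.ofReal_le_ofReal ?_
        have := hMf z.2 (ball_subset_closedBall hz.2)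
        rwa [Real.norm_of_nonneg (frobeniusNormSq_nonneg _)] at this
      calc ∫⁻ z in Icc (-R ^ 2) (R ^ 2) ×ˢ ball (0 : EuclideanSpace ℝ (Fin 3)) R,
            ENNReal.ofReal (frobeniusNormSq (fderiv ℝ U z.2))
          ≤ ∫⁻ _ in Icc (-R ^ 2) (R ^ 2) ×ˢ ball (0 : EuclideanSpace ℝ (Fin 3)) R,
              ENNReal.ofReal Mf :=
            setLIntegral_mono measurable_const hle
        _ = ENNReal.ofReal Mf *
              volume (Icc (-R ^ 2) (R ^ 2) ×ˢ ball (0 : EuclideanSpace ℝ (Fin 3)) R) :=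
            setLIntegral_const _ _
        _ < ⊤ := ENNReal.mul_lt_top ENNReal.ofReal_lt_top
            ((measure_mono (prod_mono_right ball_subset_closedBall)).trans_lt
              ((isCompact_Icc.prod (isCompact_closedBall _ _)).measure_lt_top))
  · -- (5) the pressure-free weak form against divergence-free space–time tests
    intro ψ hψ hψdiv
    have hu : ContDiffOn ℝ 2 (uncurry fun _ : ℝ => U) (univ ×ˢ univ) :=
      (hU2.comp contDiff_snd).contDiffOn
    have hp : ContDiffOn ℝ 1 (uncurry fun _ : ℝ => P) (univ ×ˢ univ) :=
      (hP1.comp contDiff_snd).contDiffOn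
    have hf : ContinuousOn (uncurry fun (_ : ℝ) (_ : EuclideanSpace ℝ (Fin 3)) =>
        (0 : EuclideanSpace ℝ (Fin 3))) (univ ×ˢ univ) :=
      continuousOn_const
    obtain ⟨-, -, -, -, hI0⟩ : IsDistributionalNSSolutionOn
        (slab (EuclideanSpace ℝ (Fin 3)) univ isOpen_univ) 1
        (fun (_ : ℝ) (_ : EuclideanSpace ℝ (Fin 3)) => (0 : EuclideanSpace ℝ (Fin 3)))
        (fun _ : ℝ => U) (fun _ : ℝ => P) := by
      refine isDistributionalNSSolutionOn_of_contDiffOn isOpen_univ hQ hu hp hf (fun t _ x => ?_)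
        (fun _ _ => hprof.divFree)
      have h := hprof.profile_eq x
      simp only [one_smul, zero_smul, add_zero] at h
      rw [add_assoc, neg_add_eq_zero] at h
      simp only [timeDeriv_apply, deriv_const, zero_add, one_smul, add_zero]
      rw [h, add_sub_cancel_right]
    have hI := hI0 ψ hψ
    have hdiv0 : ∀ t x, VectorCalculus.divergence (ψ t) x = 0 := fun t x => hψdiv t x
    simp only [hdiv0, mul_zero, add_zero, inner_zero_left, one_mul] at hI
    have hK' : IsCompact (tsupport (uncurry ψ)) := hψ.hasCompactSupport
    have hKQ : tsupport (uncurry ψ) ⊆ ((slab (EuclideanSpace ℝ (Fin 3)) univ isOpen_univ :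
        Opens (ℝ × EuclideanSpace ℝ (Fin 3))) : Set (ℝ × EuclideanSpace ℝ (Fin 3))) :=
      hψ.tsupport_subset
    have cT : Continuous fun z : ℝ × EuclideanSpace ℝ (Fin 3) => timeDeriv ψ z.1 z.2 :=
      hψ.continuous_timeDeriv
    have hGc : Continuous fun z : ℝ × EuclideanSpace ℝ (Fin 3) =>
        ⟪U z.2, timeDeriv ψ z.1 z.2⟫ + ⟪U z.2, convect U (ψ z.1) z.2⟫ + ⟪U z.2, Δ (ψ z.1) z.2⟫ :=
      ((cU.inner cT).add (cU.inner (hψ.continuous_fderiv_slice.clm_apply cU))).add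
        (cU.inner hψ.continuous_laplacian_slice)
    have hG0 : ∀ z ∉ tsupport (uncurry ψ),
        ⟪U z.2, timeDeriv ψ z.1 z.2⟫ + ⟪U z.2, convect U (ψ z.1) z.2⟫ + ⟪U z.2, Δ (ψ z.1) z.2⟫
          = 0 := by
      intro z hz
      have e1 : timeDeriv ψ z.1 z.2 = 0 := timeDeriv_eq_zero_off_tsupport hz
      have e2 : fderiv ℝ (ψ z.1) z.2 = 0 :=
        fderiv_of_notMem_tsupport ℝ (notMem_tsupport_slice_of_notMem hz)
      have e3 : (Δ (ψ z.1)) z.2 = 0 :=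
        laplacian_eq_zero_of_notMem_tsupport (notMem_tsupport_slice_of_notMem hz)
      simp only [convect, e1, e2, e3, inner_zero_right, _root_.zero_apply, add_zero]
    rw [setIntegral_eq_integral_integral_of_continuousOn isOpen_univ hK' hKQ hQ hGc.continuousOn
      hG0] at hI
    simpa using hI

/-- A bounded field, viewed as time-independent, satisfies the growth clause with `h = 0` and
`M = 4K²|B₁|`. [folklore] -/
theorem growth_zero_of_bounded {U : EuclideanSpace ℝ (Fin 3) → EuclideanSpace ℝ (Fin 3)} {K : ℝ}
    (hK : ∀ x, ‖U x‖ ≤ K) :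
    Growth 0 ((2 * K) ^ 2 * (volume (ball (0 : EuclideanSpace ℝ (Fin 3)) 1)).toReal)
      (fun _ : ℝ => U) := by
  have hK0 : 0 ≤ K := (norm_nonneg _).trans (hK 0)
  have hV : ENNReal.ofReal (volume (ball (0 : EuclideanSpace ℝ (Fin 3)) 1)).toReal =
      volume (ball (0 : EuclideanSpace ℝ (Fin 3)) 1) :=
    ENNReal.ofReal_toReal measure_ball_lt_top.ne
  dsimp only [Growth]
  intro R hR
  have hR0 : 0 < R := by linarith
  refine Eventually.of_forall fun t _ => ?_
  have havg : ‖⨍ y in ball (0 : EuclideanSpace ℝ (Fin 3)) R, U y‖ ≤ K := by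
    rw [setAverage_eq, norm_smul, norm_inv, Real.norm_of_nonneg measureReal_nonneg]
    rcases (measureReal_nonneg : 0 ≤ volume.real (ball (0 : EuclideanSpace ℝ (Fin 3)) R)).eq_or_lt
      with h0 | _
    · rw [← h0, inv_zero, zero_mul]
      exact hK0
    · calc (volume.real (ball (0 : EuclideanSpace ℝ (Fin 3)) R))⁻¹ *
            ‖∫ y in ball (0 : EuclideanSpace ℝ (Fin 3)) R, U y‖
          ≤ (volume.real (ball (0 : EuclideanSpace ℝ (Fin 3)) R))⁻¹ *
              (K * volume.real (ball (0 : EuclideanSpace ℝ (Fin 3)) R)) := by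
            gcongr
            exact norm_setIntegral_le_of_norm_le_const measure_ball_lt_top fun x _ => hK x
        _ = K := by field_simp
  have hpt : ∀ x, ‖U x - ⨍ y in ball (0 : EuclideanSpace ℝ (Fin 3)) R, U y‖ₑ ^ 2 ≤
      ENNReal.ofReal ((2 * K) ^ 2) := by
    intro x
    rw [ENNReal.ofReal_pow (by positivity), ← ofReal_norm]
    refine pow_le_pow_left' (ENNReal.ofReal_le_ofReal ?_) 2
    calc ‖U x - ⨍ y in ball (0 : EuclideanSpace ℝ (Fin 3)) R, U y‖
        ≤ ‖U x‖ + ‖⨍ y in ball (0 : EuclideanSpace ℝ (Fin 3)) R, U y‖ := norm_sub_le _ _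
      _ ≤ K + K := add_le_add (hK x) havg
      _ = 2 * K := by ring
  have h3 : R ^ (3 + 2 * (0 : ℝ)) = R ^ (3 : ℕ) := by
    rw [show (3 : ℝ) + 2 * 0 = ((3 : ℕ) : ℝ) by norm_num, Real.rpow_natCast]
  calc ∫⁻ x in ball (0 : EuclideanSpace ℝ (Fin 3)) R,
        ‖U x - ⨍ y in ball (0 : EuclideanSpace ℝ (Fin 3)) R, U y‖ₑ ^ 2
      ≤ ∫⁻ _ in ball (0 : EuclideanSpace ℝ (Fin 3)) R, ENNReal.ofReal ((2 * K) ^ 2) :=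
        setLIntegral_mono measurable_const fun x _ => hpt x
    _ = ENNReal.ofReal ((2 * K) ^ 2) * volume (ball (0 : EuclideanSpace ℝ (Fin 3)) R) :=
        setLIntegral_const _ _
    _ = ENNReal.ofReal ((2 * K) ^ 2) *
          (ENNReal.ofReal (R ^ 3) * volume (ball (0 : EuclideanSpace ℝ (Fin 3)) 1)) := by
        rw [Measure.addHaar_ball_of_pos volume _ hR0, finrank_euclideanSpace_fin]
    _ = ENNReal.ofReal ((2 * K) ^ 2 * (volume (ball (0 : EuclideanSpace ℝ (Fin 3)) 1)).toReal *
          R ^ (3 + 2 * (0 : ℝ))) := by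
        rw [h3, ENNReal.ofReal_mul (by positivity), ENNReal.ofReal_mul (by positivity), hV]
        ring

/-- **D-solutions are quiet**: a `C²` steady field with finite Dirichlet integral, viewed as
time-independent, has `∫∫_{Q_R} |∇U|² ≤ 2R² ∫_{ℝ³} |∇U|² = o(R⁵)`. [folklore] -/
theorem quiet_of_finiteDirichlet
    {U : EuclideanSpace ℝ (Fin 3) → EuclideanSpace ℝ (Fin 3)} (hU2 : ContDiff ℝ 2 U)
    (hD : (∫⁻ x, ENNReal.ofReal (frobeniusNormSq (fderiv ℝ U x))) < ⊤) :
    Quiet (fun _ : ℝ => U) := by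
  have hU1 : ContDiff ℝ 1 U := hU2.of_le one_le_two
  have hQ : ((slab (EuclideanSpace ℝ (Fin 3)) univ isOpen_univ :
      Opens (ℝ × EuclideanSpace ℝ (Fin 3))) : Set (ℝ × EuclideanSpace ℝ (Fin 3))) ⊆ univ ×ˢ univ :=
    fun z _ => ⟨mem_univ _, mem_univ _⟩
  set F : EuclideanSpace ℝ (Fin 3) → ℝ≥0∞ :=
    fun x => ENNReal.ofReal (frobeniusNormSq (fderiv ℝ U x)) with hF
  have hFm : Measurable F :=
    (LerayHopfProofs.continuous_frobeniusNormSq.comp (hU1.continuous_fderiv one_ne_zero)).measurable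
      |>.ennreal_ofReal
  set D : ℝ≥0∞ := ∫⁻ x, F x with hDdef
  have hDr : D = ENNReal.ofReal D.toReal := (ENNReal.ofReal_toReal hD.ne).symm
  refine ⟨fun _ x => fderiv ℝ U x, ?_, ?_⟩
  · have hu1 : ContDiffOn ℝ 1 (uncurry fun _ : ℝ => U) (univ ×ˢ univ) :=
      (hU1.comp contDiff_snd).contDiffOn
    exact hasWeakSpatialGradientOn_of_contDiffOn isOpen_univ hQ hu1
  · intro ε hε
    refine ⟨max 1 (2 * D.toReal / ε), le_max_left _ _, fun R hR => ?_⟩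
    have hR1 : 1 ≤ R := le_of_max_le_left hR
    have hR0 : 0 < R := by linarith
    -- slice the cylinder integral: `∫∫_{[-R²,R²] × B_R} F ≤ |[-R²,R²]| · ∫_{ℝ³} F`
    have hprod : ((volume : Measure ℝ).restrict (Icc (-R ^ 2) (R ^ 2))).prod
        ((volume : Measure (EuclideanSpace ℝ (Fin 3))).restrict univ) =
        (volume : Measure (ℝ × EuclideanSpace ℝ (Fin 3))).restrict
          (Icc (-R ^ 2) (R ^ 2) ×ˢ (univ : Set (EuclideanSpace ℝ (Fin 3)))) := by
      rw [Measure.prod_restrict, ← Measure.volume_eq_prod]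
    have hslice : ∫⁻ z in Icc (-R ^ 2) (R ^ 2) ×ˢ ball (0 : EuclideanSpace ℝ (Fin 3)) R, F z.2
        ≤ ENNReal.ofReal (2 * R ^ 2) * D := by
      calc ∫⁻ z in Icc (-R ^ 2) (R ^ 2) ×ˢ ball (0 : EuclideanSpace ℝ (Fin 3)) R, F z.2
          ≤ ∫⁻ z in Icc (-R ^ 2) (R ^ 2) ×ˢ (univ : Set (EuclideanSpace ℝ (Fin 3))), F z.2 :=
            lintegral_mono_set (prod_mono_right (subset_univ _))
        _ = ∫⁻ z, (fun _ : ℝ => (1 : ℝ≥0∞)) z.1 * F z.2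
              ∂(((volume : Measure ℝ).restrict (Icc (-R ^ 2) (R ^ 2))).prod
                ((volume : Measure (EuclideanSpace ℝ (Fin 3))).restrict univ)) := by
            rw [hprod]
            simp only [one_mul]
        _ = (∫⁻ _ in Icc (-R ^ 2) (R ^ 2), (1 : ℝ≥0∞)) *
              ∫⁻ x in (univ : Set (EuclideanSpace ℝ (Fin 3))), F x :=
            lintegral_prod_mul aemeasurable_const hFm.aemeasurable
        _ = ENNReal.ofReal (2 * R ^ 2) * D := by
            rw [setLIntegral_one, Measure.restrict_univ, Real.volume_Icc]
            congr 2
            ring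
    -- arithmetic: `2R² · D ≤ ε R⁵` once `R ≥ max 1 (2D/ε)`
    have h2D : 2 * D.toReal ≤ ε * R := by
      have := (div_le_iff₀ hε).1 (le_of_max_le_right hR)
      linarith
    have hRR : R ≤ R ^ 3 := by
      have h1 : 1 ≤ R ^ 2 := one_le_pow₀ hR1
      calc R = R * 1 := (mul_one R).symm
        _ ≤ R * R ^ 2 := mul_le_mul_of_nonneg_left h1 hR0.le
        _ = R ^ 3 := by ring
    have hfinal : 2 * R ^ 2 * D.toReal ≤ ε * R ^ 5 :=
      calc 2 * R ^ 2 * D.toReal = R ^ 2 * (2 * D.toReal) := by ring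
        _ ≤ R ^ 2 * (ε * R ^ 3) :=
            mul_le_mul_of_nonneg_left (h2D.trans (mul_le_mul_of_nonneg_left hRR hε.le))
              (sq_nonneg R)
        _ = ε * R ^ 5 := by ring
    calc ∫⁻ z in Icc (-R ^ 2) (R ^ 2) ×ˢ ball (0 : EuclideanSpace ℝ (Fin 3)) R, F z.2
        ≤ ENNReal.ofReal (2 * R ^ 2) * D := hslice
      _ = ENNReal.ofReal (2 * R ^ 2 * D.toReal) := by
          rw [ENNReal.ofReal_mul (p := 2 * R ^ 2) (by positivity), ← hDr]
      _ ≤ ENNReal.ofReal (ε * R ^ 5) := ENNReal.ofReal_le_ofReal hfinal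

/-- **The quiet half still decides Galdi's Liouville problem**: `QuietLiouville` ⇒
`Literature.Analysis.FluidPDE.SteadyDSolutionLiouvilleProblem` (registered `[status: open]`;
Galdi 2011, §I.2; Tsai 2018, Conj. 2.5). A D-solution is bounded (decay), sits in the class
(`inEternalClass_of_isLerayProfile`), has `h = 0` growth (`growth_zero_of_bounded`) and is quiet
(`quiet_of_finiteDirichlet`); the quiet Liouville half returns an a.e.-constant slice, continuity
makes `u` constant and decay makes it `0`. [cite: Galdi2011, §I.2] -/
theorem steadyDSolutionLiouvilleProblem_of_quietLiouville (hQ : QuietLiouville) :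
    SteadyDSolutionLiouvilleProblem := by
  intro u p hprof _ _ hD hdecay
  have huc : Continuous u := hprof.contDiff_velocity.continuous
  obtain ⟨K, hK⟩ : ∃ K : ℝ, ∀ x, ‖u x‖ ≤ K := by
    have hev : ∀ᶠ x in cocompact (EuclideanSpace ℝ (Fin 3)), dist (u x) 0 < 1 :=
      Metric.tendsto_nhds.1 hdecay 1 one_pos
    obtain ⟨S, hSc, hSsub⟩ := mem_cocompact.1 hev
    obtain ⟨C, hCb⟩ := hSc.exists_bound_of_continuousOn huc.continuousOn
    refine ⟨max C 1, fun x => ?_⟩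
    by_cases hx : x ∈ S
    · exact (hCb x hx).trans (le_max_left _ _)
    · have hx' : dist (u x) 0 < 1 := hSsub hx
      rw [dist_zero_right] at hx'
      exact hx'.le.trans (le_max_right _ _)
  have hS : SliceConst (fun _ : ℝ => u) :=
    hQ 0 _ zero_lt_one (fun _ : ℝ => u) (inEternalClass_of_isLerayProfile hprof)
      (growth_zero_of_bounded hK) (quiet_of_finiteDirichlet hprof.contDiff_velocity hD)
  dsimp only [SliceConst] at hS
  obtain ⟨_, b, hb⟩ := hS.exists
  have hub : u = fun _ => b := (huc.ae_eq_iff_eq volume continuous_const).1 hb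
  subst hub
  have hb0 : b = 0 := tendsto_const_nhds_iff.1 hdecay
  subst hb0
  rfl

end Summit.AnomalousDissipation.AnomalousDissipation.Cruxes.SubBallisticLiouville.StrategistR1

end
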